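import Summits.AtomisticToContinuum.Crystallization.Theorems.FrustratedLawDichotomyScalarBoundsP

/-!
# FrustratedLawDichotomy · crux `AperiodicFrustratedLawGap` (stmt-AtomisticToContinuum-27623) — the scalar-bounds P through the
# tolerance door: generic `θ`, the fallback literal `θ = 1/200`, hand 1's `R`, and the dial (decomp-a2c, prover hand 2, gen 10)

`capForcing_of_scalarBounds` (p823696) gives `CapForcing θ` from the four 12-point scalar bounds `LinkPairBound θ D₀ √3`,
`LinkDiagonalBound θ d₀` (fcc, hcp) under two numerical lens conditions.  This def-free file chains it with the tolerance door
(`FrustratedLawDichotomyTwoShellRigidityCutTol`, p820444), hand 1's `R` (`…TwoShellRigidityCoarse`, p822606) and records the constants for the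
fallback literal `θ = 1/200` (`D₀ = 5/3`, `d₀ = 23/20`):

* `aperiodicFrustratedLawGap_of_price_of_scalarBounds_tol` : `0 < θ ≤ 1/100`, `η < 1/20`, `MuEquilibriumDoor`, `PriceTol θ`, `LinkCert θ`, the four
  scalar bounds at `θ` (with the two lens conditions), `CappedCert θ η` fcc/hcp ⟹ crux;
* `num3_twoHundredth`, `num5_twoHundredth`, `capForcing_twoHundredth_of_scalarBounds`, `aperiodicFrustratedLawGap_of_price_of_scalarBounds_200`;
* `aperiodicFrustratedLawGap_of_scalarBounds_of_basinCertificate` (M via `BasinCertificate 4796 (1/100) (1/20)`),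
  `aperiodicFrustratedLawGap_dial_of_scalarBounds` (certificate-free in M for `θ < 1/95920`), and the item-26654 siblings.
`[folklore]`; def-free; no `sorry`.
-/

noncomputable section

namespace Summit.AtomisticToContinuum.Crystallization.Theorems.FrustratedLawDichotomyScalarBoundsPTol

open Literature.Geometry.DiscreteGeometry
open Summit.AtomisticToContinuum.Crystallization.Theses.PricedLinkCensus (ChargedEnergyGap)
open Summit.AtomisticToContinuum.Crystallization.Theorems.FrustratedLawDichotomyTwoShellRigidityCut (E3 CapForcing)
open Summit.AtomisticToContinuum.Crystallization.Theorems.FrustratedLawDichotomyTwoShellRigidityCells (PriceTol BasinCertificate)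
open Summit.AtomisticToContinuum.Crystallization.Theorems.FrustratedLawDichotomyTwoShellRigidityCoarse
  (aperiodicFrustratedLawGap_of_basinCertificate noFrustratedPeriodicMinimiser_of_basinCertificate aperiodicFrustratedLawGap_dial
    noFrustratedPeriodicMinimiser_dial)
open Summit.AtomisticToContinuum.Crystallization.Theorems.FrustratedLawDichotomyCappedRigidityCert (CappedCert)
open Summit.AtomisticToContinuum.Crystallization.Theorems.FrustratedLawDichotomyCappedRigidityCertPatterns (cappedRigidity_of_cert)
open Summit.AtomisticToContinuum.Crystallization.Theorems.FrustratedLawDichotomyLinkCert (LinkCert linkClassification_of_linkCert)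
open Summit.AtomisticToContinuum.Crystallization.Theorems.FrustratedLawDichotomyTwoShellRigidityCutTol
  (aperiodicFrustratedLawGap_of_price_of_cut_tol)
open Summit.AtomisticToContinuum.Crystallization.Theorems.FrustratedLawDichotomyCapMatchOfDiagonal (LinkDiagonalBound)
open Summit.AtomisticToContinuum.Crystallization.Theorems.FrustratedLawDichotomyNoTwistOfPairBound (LinkPairBound)
open Summit.AtomisticToContinuum.Crystallization.Theorems.FrustratedLawDichotomyScalarBoundsP
  (capForcing_of_scalarBounds capForcing_hundredth_of_scalarBounds)

/-- **Crux through the tolerance door from the scalar-bounds P** (`0 < θ ≤ 1/100`, `η < 1/20`). [folklore] -/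
theorem aperiodicFrustratedLawGap_of_price_of_scalarBounds_tol {θ η D₀ d₀ : ℝ} (hθ0 : 0 < θ) (hθ1 : θ ≤ 1 / 100) (hη : η < 1 / 20)
    (hD₀ : 0 < D₀) (hd₀ : 0 < d₀)
    (hnum3 : 3 * (((1 + θ) ^ 2) ^ 2 - D₀ ^ 2 / 4) < (1 + θ)⁻¹ ^ 2 - ((((1 + θ) ^ 2) ^ 2 - (1 + θ)⁻¹ ^ 2) / D₀) ^ 2)
    (hnum5 : (5 - Real.sqrt 5) / 2 * (((1 + θ) ^ 2) ^ 2 - d₀ ^ 2 / 4) <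
      ((1 + θ)⁻¹ ^ 2) ^ 2 - ((((1 + θ) ^ 2) ^ 2 - (1 + θ)⁻¹ ^ 2) / d₀) ^ 2)
    (hDoor : Summit.AtomisticToContinuum.Crystallization.Theses.GrainCoreNetworkSplit.MuEquilibriumDoor) (hprice : PriceTol θ)
    (hG : LinkCert θ)
    (hBf : LinkPairBound θ D₀ (Real.sqrt 3) fccKissingPattern) (hBh : LinkPairBound θ D₀ (Real.sqrt 3) hcpKissingPattern)
    (hDf : LinkDiagonalBound θ d₀ fccKissingPattern) (hDh : LinkDiagonalBound θ d₀ hcpKissingPattern)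
    (hMf : CappedCert θ η fccKissingPattern) (hMh : CappedCert θ η hcpKissingPattern) :
    Summit.AtomisticToContinuum.Crystallization.Theses.FrustratedLawDichotomy.AperiodicFrustratedLawGap :=
  aperiodicFrustratedLawGap_of_price_of_cut_tol hθ0 hθ1 hη hDoor hprice (linkClassification_of_linkCert hG)
    (capForcing_of_scalarBounds hθ0.le hD₀ hd₀ hnum3 hnum5 hBf hBh hDf hDh) (cappedRigidity_of_cert hMf hMh)

/-- The three-point lens condition at `θ = 1/200`, `D₀ = 5/3`. [folklore] -/
theorem num3_twoHundredth :
    3 * (((1 + (1 / 200 : ℝ)) ^ 2) ^ 2 - (5 / 3 : ℝ) ^ 2 / 4) <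
      (1 + (1 / 200 : ℝ))⁻¹ ^ 2 - ((((1 + (1 / 200 : ℝ)) ^ 2) ^ 2 - (1 + (1 / 200 : ℝ))⁻¹ ^ 2) / (5 / 3 : ℝ)) ^ 2 := by
  norm_num

/-- The five-point lens condition at `θ = 1/200`, `d₀ = 23/20`. [folklore] -/
theorem num5_twoHundredth :
    (5 - Real.sqrt 5) / 2 * (((1 + (1 / 200 : ℝ)) ^ 2) ^ 2 - (23 / 20 : ℝ) ^ 2 / 4) <
      ((1 + (1 / 200 : ℝ))⁻¹ ^ 2) ^ 2 - ((((1 + (1 / 200 : ℝ)) ^ 2) ^ 2 - (1 + (1 / 200 : ℝ))⁻¹ ^ 2) / (23 / 20 : ℝ)) ^ 2 := by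
  have h5 : (2236 / 1000 : ℝ) < Real.sqrt 5 := by
    rw [show (2236 / 1000 : ℝ) = Real.sqrt ((2236 / 1000) ^ 2) by rw [Real.sqrt_sq]; norm_num]
    exact Real.sqrt_lt_sqrt (by norm_num) (by norm_num)
  norm_num
  nlinarith [h5]

/-- **`CapForcing (1/200)` from `LinkPairBound (1/200) (5/3) √3` and `LinkDiagonalBound (1/200) (23/20)`, fcc and hcp.** [folklore] -/
theorem capForcing_twoHundredth_of_scalarBounds
    (hBf : LinkPairBound (1 / 200) (5 / 3) (Real.sqrt 3) fccKissingPattern)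
    (hBh : LinkPairBound (1 / 200) (5 / 3) (Real.sqrt 3) hcpKissingPattern)
    (hDf : LinkDiagonalBound (1 / 200) (23 / 20) fccKissingPattern) (hDh : LinkDiagonalBound (1 / 200) (23 / 20) hcpKissingPattern) :
    CapForcing (1 / 200) :=
  capForcing_of_scalarBounds (by norm_num) (by norm_num) (by norm_num) num3_twoHundredth num5_twoHundredth hBf hBh hDf hDh

/-- **The fallback literal `θ = 1/200` by name**: `MuEquilibriumDoor ∧ PriceTol (1/200) ∧ LinkCert (1/200)`, the four scalar bounds at
`1/200` (`D₀ = 5/3`, `d₀ = 23/20`) and `CappedCert (1/200) η` (`η < 1/20`) ⟹ `AperiodicFrustratedLawGap`. [folklore] -/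
theorem aperiodicFrustratedLawGap_of_price_of_scalarBounds_200 {η : ℝ} (hη : η < 1 / 20)
    (hDoor : Summit.AtomisticToContinuum.Crystallization.Theses.GrainCoreNetworkSplit.MuEquilibriumDoor) (hprice : PriceTol (1 / 200))
    (hG : LinkCert (1 / 200))
    (hBf : LinkPairBound (1 / 200) (5 / 3) (Real.sqrt 3) fccKissingPattern)
    (hBh : LinkPairBound (1 / 200) (5 / 3) (Real.sqrt 3) hcpKissingPattern)
    (hDf : LinkDiagonalBound (1 / 200) (23 / 20) fccKissingPattern) (hDh : LinkDiagonalBound (1 / 200) (23 / 20) hcpKissingPattern)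
    (hMf : CappedCert (1 / 200) η fccKissingPattern) (hMh : CappedCert (1 / 200) η hcpKissingPattern) :
    Summit.AtomisticToContinuum.Crystallization.Theses.FrustratedLawDichotomy.AperiodicFrustratedLawGap :=
  aperiodicFrustratedLawGap_of_price_of_scalarBounds_tol (by norm_num) (by norm_num) hη (by norm_num) (by norm_num)
    num3_twoHundredth num5_twoHundredth hDoor hprice hG hBf hBh hDf hDh hMf hMh

/-- **With hand 1's `R`**: `MuEquilibriumDoor ∧ ChargedEnergyGap ∧ LinkCert (1/100)`, the four scalar bounds at `1/100` and
`BasinCertificate 4796 (1/100) (1/20) ⟹ AperiodicFrustratedLawGap`. [folklore] -/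
theorem aperiodicFrustratedLawGap_of_scalarBounds_of_basinCertificate
    (hDoor : Summit.AtomisticToContinuum.Crystallization.Theses.GrainCoreNetworkSplit.MuEquilibriumDoor) (hgap : ChargedEnergyGap)
    (hG : LinkCert (1 / 100))
    (hBf : LinkPairBound (1 / 100) (17 / 10) (Real.sqrt 3) fccKissingPattern)
    (hBh : LinkPairBound (1 / 100) (17 / 10) (Real.sqrt 3) hcpKissingPattern)
    (hDf : LinkDiagonalBound (1 / 100) (6 / 5) fccKissingPattern) (hDh : LinkDiagonalBound (1 / 100) (6 / 5) hcpKissingPattern)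
    (hL : BasinCertificate 4796 (1 / 100) (1 / 20)) :
    Summit.AtomisticToContinuum.Crystallization.Theses.FrustratedLawDichotomy.AperiodicFrustratedLawGap :=
  aperiodicFrustratedLawGap_of_basinCertificate hDoor hgap (linkClassification_of_linkCert hG)
    (capForcing_hundredth_of_scalarBounds hBf hBh hDf hDh) hL

/-- **Item 26654 sibling** with hand 1's `R`. [folklore] -/
theorem noFrustratedPeriodicMinimiser_of_scalarBounds_of_basinCertificate (hgap : ChargedEnergyGap) (hG : LinkCert (1 / 100))
    (hBf : LinkPairBound (1 / 100) (17 / 10) (Real.sqrt 3) fccKissingPattern)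
    (hBh : LinkPairBound (1 / 100) (17 / 10) (Real.sqrt 3) hcpKissingPattern)
    (hDf : LinkDiagonalBound (1 / 100) (6 / 5) fccKissingPattern) (hDh : LinkDiagonalBound (1 / 100) (6 / 5) hcpKissingPattern)
    (hL : BasinCertificate 4796 (1 / 100) (1 / 20)) :
    Summit.AtomisticToContinuum.Crystallization.Theses.PeriodicChargeSplit.NoFrustratedPeriodicMinimiser :=
  noFrustratedPeriodicMinimiser_of_basinCertificate hgap (linkClassification_of_linkCert hG)
    (capForcing_hundredth_of_scalarBounds hBf hBh hDf hDh) hL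

/-- **The dial, certificate-free in M**: for `0 < θ < 1/95920`, `MuEquilibriumDoor ∧ PriceTol θ ∧ LinkCert θ` and the four scalar bounds at
`θ` (with the lens conditions) `⟹ AperiodicFrustratedLawGap`. [folklore] -/
theorem aperiodicFrustratedLawGap_dial_of_scalarBounds {θ D₀ d₀ : ℝ} (hθ0 : 0 < θ) (hθ : θ < 1 / 95920) (hD₀ : 0 < D₀) (hd₀ : 0 < d₀)
    (hnum3 : 3 * (((1 + θ) ^ 2) ^ 2 - D₀ ^ 2 / 4) < (1 + θ)⁻¹ ^ 2 - ((((1 + θ) ^ 2) ^ 2 - (1 + θ)⁻¹ ^ 2) / D₀) ^ 2)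
    (hnum5 : (5 - Real.sqrt 5) / 2 * (((1 + θ) ^ 2) ^ 2 - d₀ ^ 2 / 4) <
      ((1 + θ)⁻¹ ^ 2) ^ 2 - ((((1 + θ) ^ 2) ^ 2 - (1 + θ)⁻¹ ^ 2) / d₀) ^ 2)
    (hDoor : Summit.AtomisticToContinuum.Crystallization.Theses.GrainCoreNetworkSplit.MuEquilibriumDoor) (hprice : PriceTol θ)
    (hG : LinkCert θ)
    (hBf : LinkPairBound θ D₀ (Real.sqrt 3) fccKissingPattern) (hBh : LinkPairBound θ D₀ (Real.sqrt 3) hcpKissingPattern)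
    (hDf : LinkDiagonalBound θ d₀ fccKissingPattern) (hDh : LinkDiagonalBound θ d₀ hcpKissingPattern) :
    Summit.AtomisticToContinuum.Crystallization.Theses.FrustratedLawDichotomy.AperiodicFrustratedLawGap :=
  aperiodicFrustratedLawGap_dial hθ0 hθ hDoor hprice (linkClassification_of_linkCert hG)
    (capForcing_of_scalarBounds hθ0.le hD₀ hd₀ hnum3 hnum5 hBf hBh hDf hDh)

/-- **The dial, door-free sibling (item 26654).** [folklore] -/
theorem noFrustratedPeriodicMinimiser_dial_of_scalarBounds {θ D₀ d₀ : ℝ} (hθ0 : 0 < θ) (hθ : θ < 1 / 95920) (hD₀ : 0 < D₀)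
    (hd₀ : 0 < d₀)
    (hnum3 : 3 * (((1 + θ) ^ 2) ^ 2 - D₀ ^ 2 / 4) < (1 + θ)⁻¹ ^ 2 - ((((1 + θ) ^ 2) ^ 2 - (1 + θ)⁻¹ ^ 2) / D₀) ^ 2)
    (hnum5 : (5 - Real.sqrt 5) / 2 * (((1 + θ) ^ 2) ^ 2 - d₀ ^ 2 / 4) <
      ((1 + θ)⁻¹ ^ 2) ^ 2 - ((((1 + θ) ^ 2) ^ 2 - (1 + θ)⁻¹ ^ 2) / d₀) ^ 2)
    (hprice : PriceTol θ) (hG : LinkCert θ)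
    (hBf : LinkPairBound θ D₀ (Real.sqrt 3) fccKissingPattern) (hBh : LinkPairBound θ D₀ (Real.sqrt 3) hcpKissingPattern)
    (hDf : LinkDiagonalBound θ d₀ fccKissingPattern) (hDh : LinkDiagonalBound θ d₀ hcpKissingPattern) :
    Summit.AtomisticToContinuum.Crystallization.Theses.PeriodicChargeSplit.NoFrustratedPeriodicMinimiser :=
  noFrustratedPeriodicMinimiser_dial hθ0 hθ hprice (linkClassification_of_linkCert hG)
    (capForcing_of_scalarBounds hθ0.le hD₀ hd₀ hnum3 hnum5 hBf hBh hDf hDh)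

end Summit.AtomisticToContinuum.Crystallization.Theorems.FrustratedLawDichotomyScalarBoundsPTol

end
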